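import Mathlib
import HarnessLib
import Literature.Analysis.FluidPDE.FirstIntegralTransportDefect
import Summits.NavierStokesRegularity.NavierStokesRegularity.Theorems.PoloidalWindowDoorLrcModEntireTwistingTHPlaneOscillation
import Summits.NavierStokesRegularity.NavierStokesRegularity.Theorems.PoloidalWindowDoorLrcModEntireTwistingTHFlatRidgePressurePins
import Summits.NavierStokesRegularity.NavierStokesRegularity.Theorems.PoloidalWindowDoorLrcModEntireQ4SonicHotSheetNormalForm

/-!
# Route `PoloidalWindowDoor`, item `LrcModEntire` (stmt-NavierStokesRegularity-20428), cell (Q4-sonic), slot `stub_Q4sonicLineNeg` —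
# B-SPEED, II: THE NORMAL DERIVATIVE OF `∂ₜU₂` AT A CRITICAL POINT OF THE (TH) COLUMN (the source of the web-speed law)

Cell ns-regularity-ideate, helper seat ns-k2-port-2 g8 under the LEAD of item 20428 (ns-poloidal-K2-p3 g17, memo `T2B-g17.md` §4 «B-SPEED … port-2»);
`--supports stmt-NavierStokesRegularity-20428 --as helper`.  At a point `W` of the slice `t = −1` where `∇U₂(−1,·)(W) = 0` (every point of the hot/sonic sheet),
the doubled weight source `2𝒜 = 2(1−μ)f₂ − 2(μ_t − μ_zz)U₂ − μ_zU₂² + 4μ_z∂₂U₂` of the (TH) column is constant on horizontal planes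
(K2-p2 g4 `…TimeHeightShearWeight` / `…TwistingTHPlaneOscillation.weightSource_eq_of_height_eq`); differentiating it along the horizontal line `W + r·Je` and expanding
`f₂ = ∂ₜU₂ + DU₂[U] − ΔU₂` gives, with `θ = U₂(−1,·)`, `μ = μ(−1,W₂)`, `μ_z = ∂_zμ(−1,W₂)`, `μ ≠ 1`:

* ★ `normalDeriv_timeDeriv_of_critical` — **`D(∂ₜU₂(−1,·))(W)[Je] = D(Δθ)(W)[Je] − D²θ(W)[Je, U(−1,W)] − 2μ_z·D²θ(W)[Je,e₂]/(1−μ)`**.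

On the straight sonic sheet the right side is explicit by the cell's bricks: `D(Δθ)(W)[Je] = (1+d′²)·D³θ(W)[Je,Je,Je]` (`…Q4SonicSheetSpeed.laplacian_normalDeriv_of_sonicSheet`),
`D²θ(W)[Je,U] = a·(U·Je − d′N)` and `D²θ(W)[Je,e₂] = −d′a` (`…Q4SonicHotSheetNormalForm.sonic_sheet_hessian_normalForm`), so with g6's speed law
`a·V = −D(∂ₜU₂)(W)[Je]` (`…RidgeWebDynamics.sheetSpeed_eq_fderiv_timeDeriv`): **`a·V = −(1+d′²)a₃ + a(U·Je − d′N) − 2d′aμ_z/(1−μ)`** — T2B-g17 (2c), HOT-SHEET (3a).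
WHAT THIS IS NOT: not a claim about Navier–Stokes regularity — an identity of the (TH) column at a critical point of the vertical velocity (bears on the research slot
`stub_Q4sonicLineNeg`, registry twist_split v12); no stub is closed here; items 20428 / 19708 / 27893 OPEN.
-/

noncomputable section

set_option linter.dupNamespace false
set_option linter.style.longLine false

namespace Summit.NavierStokesRegularity.NavierStokesRegularity.Theorems.PoloidalWindowDoorLrcModEntireQ4SonicSheetSpeedClass

open Set Function Filter Topology Metric
open scoped RealInnerProductSpace InnerProductSpace Laplacian ContDiff
open Literature.Analysis Literature.Analysis.FluidPDE Literature.Analysis.UnboundedOperators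
open Summit.NavierStokesRegularity.NavierStokesRegularity.Theorems
open Summit.NavierStokesRegularity.NavierStokesRegularity.Theorems.LocalSineTubeDoorProfileAlignedWindowRigidityAncient
open Summit.NavierStokesRegularity.NavierStokesRegularity.Theorems.PoloidalWindowDoorPoloidalWindowRigidityWindow
open Summit.NavierStokesRegularity.NavierStokesRegularity.Theorems.PoloidalWindowDoorPoloidalWindowRigidityLocalFrozenLaw
open Summit.NavierStokesRegularity.NavierStokesRegularity.Theorems.PoloidalWindowDoorLrcModEntireTwistingTHHotPointPins
open Summit.NavierStokesRegularity.NavierStokesRegularity.Theorems.PoloidalWindowDoorLrcModEntireSheetFlattenTools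
open Summit.NavierStokesRegularity.NavierStokesRegularity.Theorems.PoloidalWindowDoorLrcModEntireThreadPins
open Summit.NavierStokesRegularity.NavierStokesRegularity.Theorems.PoloidalWindowDoorLrcModEntireThreadPressure
open Summit.NavierStokesRegularity.NavierStokesRegularity.Theorems.PoloidalWindowDoorLrcModEntireTwistingTHPlaneOscillation
open Summit.NavierStokesRegularity.NavierStokesRegularity.Theorems.PoloidalWindowDoorLrcModEntireTwistingTHFlatRidgeMixedPin
open Summit.NavierStokesRegularity.NavierStokesRegularity.Theorems.PoloidalWindowDoorLrcModEntireTwistingTHFlatRidgeThirdJet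

variable {C : ℝ} {v : ℝ → EuclideanSpace ℝ (Fin 3) → EuclideanSpace ℝ (Fin 3)}

/-- ★ **THE NORMAL DERIVATIVE OF `∂ₜU₂` AT A CRITICAL POINT OF THE (TH) COLUMN.**  Class profile `v` (Type-I ancient mild, poloidal), (TH) slab law with a `C³`
slope `μ` in a space–time neighbourhood of every point of the plane `{y₂ = W₂}` at `t = −1`, `μ(−1,W₂) ≠ 1`, and `∇v₂(−1,·)(W) = 0`.  Then for every horizontal
unit vector `e`:
`D(∂ₜv₂(−1,·))(W)[Je] = D(Δv₂(−1,·))(W)[Je] − D²v₂(−1,·)(W)[Je][v(−1,W)] − 2∂_zμ(−1,W₂)·D²v₂(−1,·)(W)[Je][e₂]/(1 − μ(−1,W₂))`. -/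
theorem normalDeriv_timeDeriv_of_critical (hrate : HasTypeITimeDecay C v) (hcont : ContinuousOn (uncurry v) (Iio (0 : ℝ) ×ˢ univ))
    (hmild : ∀ s t : ℝ, s < t → t < 0 → ∀ x, v t x = heatExtension (v s) (t - s) x - oseenDuhamel 1 s v v t x)
    (hdiv : ∀ t < 0, VectorCalculus.IsDivFree (v t))
    (hpol : ∀ s < 0, ∀ y, ⟪curl (v s) y, EuclideanSpace.single 2 1⟫_ℝ = 0)
    {μ : ℝ → ℝ → ℝ} (hμ : ContDiff ℝ 3 (uncurry μ)) {W : EuclideanSpace ℝ (Fin 3)}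
    (hslope : ∀ y : EuclideanSpace ℝ (Fin 3), y 2 = W 2 →
      ∀ᶠ z in 𝓝 (((-1 : ℝ), y) : ℝ × EuclideanSpace ℝ (Fin 3)), ∀ b : Fin 3, b ≠ 2 →
        fderiv ℝ (v z.1) z.2 (EuclideanSpace.single 2 1) b = μ z.1 (z.2 2) * fderiv ℝ (v z.1) z.2 (EuclideanSpace.single b 1) 2)
    (hμ1 : μ (-1) (W 2) ≠ 1) (hgrad : fderiv ℝ (fun x => v (-1) x 2) W = 0) (e : EuclideanSpace ℝ (Fin 3)) :
    fderiv ℝ (fun x => deriv (fun s => v s x 2) (-1)) W (Jvec e) =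
      fderiv ℝ (Δ (fun x => v (-1) x 2)) W (Jvec e) - fderiv ℝ (fderiv ℝ (fun x => v (-1) x 2)) W (Jvec e) (v (-1) W)
        - 2 * deriv (μ (-1)) (W 2) * fderiv ℝ (fderiv ℝ (fun x => v (-1) x 2)) W (Jvec e) (EuclideanSpace.single 2 1) / (1 - μ (-1) (W 2)) := by
  have h1 : (-1 : ℝ) ∈ Iio (0 : ℝ) := by norm_num
  have hm1 : (-1 : ℝ) < 0 := by norm_num
  set θ : EuclideanSpace ℝ (Fin 3) → ℝ := fun x => v (-1) x 2 with hθdef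
  set ν : EuclideanSpace ℝ (Fin 3) := Jvec e with hν
  have hν2 : ν 2 = 0 := by simp [hν, Jvec]
  -- regularity
  have hsm : IsSmoothSpaceTimeOn (Iio 0) v := (isTypeIAncientMild_of_class hrate hcont hmild hdiv).contDiffOn
  have hslice : ContDiff ℝ ∞ (v (-1)) := hsm.contDiff_slice h1
  have hvd : Differentiable ℝ (v (-1)) := hslice.differentiable (by simp)
  have hθ3 : ContDiff ℝ 3 θ := contDiff_two_component hrate hcont hmild
  have hθ2 : ContDiff ℝ 2 θ := hθ3.of_le (by norm_num)
  have hθd : Differentiable ℝ θ := hθ3.differentiable (by norm_num)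
  have hDθd : Differentiable ℝ (fderiv ℝ θ) := (hθ3.fderiv_right (m := 2) (by norm_num)).differentiable (by norm_num)
  have hθt := (isSmoothSpaceTimeOn_two hrate hcont hmild).isSmoothSpaceTimeOn_deriv isOpen_Iio
  have hθtd : DifferentiableAt ℝ (fun x => deriv (fun s => v s x 2) (-1)) W := ((hθt.contDiff_slice h1).differentiable (by simp)) W
  have hΔd : DifferentiableAt ℝ (Δ θ) W := differentiableAt_laplacian_of_contDiffAt hθ3.contDiffAt
  have hμt3 : ContDiff ℝ 3 (μ (-1)) := hμ.comp (contDiff_const.prodMk contDiff_id)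
  have hμd : Differentiable ℝ (μ (-1)) := hμt3.differentiable (by norm_num)
  -- the residual `f₂(y) = ∂ₜv₂ + Dv₂[v] − Δv₂` as a function of `y`
  have hres : ∀ y : EuclideanSpace ℝ (Fin 3), (timeDerivWithin (Iio 0) v (-1) y + convect (v (-1)) (v (-1)) y - Δ (v (-1)) y) 2 =
      deriv (fun s => v s y 2) (-1) + fderiv ℝ θ y (v (-1) y) - (Δ θ) y := by
    intro y
    simp only [PiLp.add_apply, PiLp.sub_apply]
    rw [timeDerivWithin_eq_deriv isOpen_Iio h1 v y, deriv_apply_coord (hsm.hasDerivAt_timeLine isOpen_Iio h1 y).differentiableAt 2,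
      convect_apply, ← fderiv_apply_coord (v (-1)) (hvd y) (v (-1) y) 2,
      laplacian_apply_coord ((hslice.of_le (by norm_cast)).contDiffAt) 2]
  -- the source along the horizontal line `r ↦ W + r·ν` is constant
  set L : ℝ → EuclideanSpace ℝ (Fin 3) := fun r => W + r • ν with hL
  have hL2 : ∀ r, (L r) 2 = W 2 := fun r => by simp [hL, hν2]
  have hLd : ∀ r, HasDerivAt L ν r := fun r => by
    have h := ((hasDerivAt_id r).smul_const ν).const_add W
    simpa [hL] using h
  set S : EuclideanSpace ℝ (Fin 3) → ℝ := fun y =>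
    2 * (1 - μ (-1) (y 2)) * (timeDerivWithin (Iio 0) v (-1) y + convect (v (-1)) (v (-1)) y - Δ (v (-1)) y) 2
      - 2 * (deriv (fun s => μ s (y 2)) (-1) - deriv (deriv (μ (-1))) (y 2)) * v (-1) y 2
      - deriv (μ (-1)) (y 2) * v (-1) y 2 ^ 2
      + 4 * deriv (μ (-1)) (y 2) * fderiv ℝ (v (-1)) y (EuclideanSpace.single 2 1) 2 with hS
  have hSconst : ∀ r, S (L r) = S W := fun r =>
    weightSource_eq_of_height_eq hrate hcont hmild hdiv hpol hμ hm1 (hL2 r) (fun y hy => hslope y (by rw [hy, hL2]))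
  -- rewrite `S ∘ L` with constant coefficients and the explicit residual
  set c₀ : ℝ := μ (-1) (W 2) with hc₀
  set c₁ : ℝ := deriv (fun s => μ s (W 2)) (-1) - deriv (deriv (μ (-1))) (W 2) with hc₁
  set c₂ : ℝ := deriv (μ (-1)) (W 2) with hc₂
  set Rf : EuclideanSpace ℝ (Fin 3) → ℝ := fun y => deriv (fun s => v s y 2) (-1) + fderiv ℝ θ y (v (-1) y) - (Δ θ) y with hRf
  set Dz : EuclideanSpace ℝ (Fin 3) → ℝ := fun y => fderiv ℝ θ y (EuclideanSpace.single 2 1) with hDz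
  have hφ : ∀ r, S (L r) = 2 * (1 - c₀) * Rf (L r) - 2 * c₁ * θ (L r) - c₂ * θ (L r) ^ 2 + 4 * c₂ * Dz (L r) := by
    intro r
    simp only [hS, hRf, hDz, hθdef, hL2 r, hres, hc₀, hc₁, hc₂, ← fderiv_apply_coord (v (-1)) (hvd (L r))]
  -- derivatives along the line at `r = 0` (`L 0 = W`)
  have hL0 : L 0 = W := by simp [hL]
  have hRfd : HasFDerivAt Rf (fderiv ℝ (fun x => deriv (fun s => v s x 2) (-1)) W +
      ((fderiv ℝ θ W).comp (fderiv ℝ (v (-1)) W) + (fderiv ℝ (fderiv ℝ θ) W).flip (v (-1) W)) - fderiv ℝ (Δ θ) W) W := by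
    have hC : HasFDerivAt (fun y => fderiv ℝ θ y (v (-1) y)) ((fderiv ℝ θ W).comp (fderiv ℝ (v (-1)) W) + (fderiv ℝ (fderiv ℝ θ) W).flip (v (-1) W)) W :=
      ((hDθd W).hasFDerivAt).clm_apply ((hvd W).hasFDerivAt)
    exact (hθtd.hasFDerivAt.add hC).sub hΔd.hasFDerivAt
  have hRf' : HasDerivAt (fun r => Rf (L r)) (fderiv ℝ (fun x => deriv (fun s => v s x 2) (-1)) W ν +
      fderiv ℝ (fderiv ℝ θ) W ν (v (-1) W) - fderiv ℝ (Δ θ) W ν) 0 := by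
    have h := hRfd.comp_hasDerivAt_of_eq (0 : ℝ) (hLd 0) hL0.symm
    refine h.congr_deriv ?_
    simp only [sub_apply, add_apply, ContinuousLinearMap.comp_apply, ContinuousLinearMap.flip_apply, hgrad, zero_apply, zero_add]
  have hθ' : HasDerivAt (fun r => θ (L r)) 0 0 := by
    have h := ((hθd W).hasFDerivAt).comp_hasDerivAt_of_eq (0 : ℝ) (hLd 0) hL0.symm
    rw [hgrad] at h
    exact h.congr_deriv (by simp)
  have hDz' : HasDerivAt (fun r => Dz (L r)) (fderiv ℝ (fderiv ℝ θ) W ν (EuclideanSpace.single 2 1)) 0 := by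
    have hd : DifferentiableAt ℝ Dz W := (hDθd W).clm_apply (differentiableAt_const _)
    have h := hd.hasFDerivAt.comp_hasDerivAt_of_eq (0 : ℝ) (hLd 0) hL0.symm
    refine h.congr_deriv ?_
    rw [hDz, nested_eq_fderiv_fderiv hθ2]
  -- the derivative of the (constant) source along the line vanishes
  have hcomb : HasDerivAt (fun r => 2 * (1 - c₀) * Rf (L r) - 2 * c₁ * θ (L r) - c₂ * θ (L r) ^ 2 + 4 * c₂ * Dz (L r))
      (2 * (1 - c₀) * (fderiv ℝ (fun x => deriv (fun s => v s x 2) (-1)) W ν + fderiv ℝ (fderiv ℝ θ) W ν (v (-1) W) - fderiv ℝ (Δ θ) W ν)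
        - 2 * c₁ * 0 - c₂ * (↑2 * θ (L 0) ^ (2 - 1) * 0) + 4 * c₂ * fderiv ℝ (fderiv ℝ θ) W ν (EuclideanSpace.single 2 1)) 0 :=
    (((hRf'.const_mul _).sub (hθ'.const_mul _)).sub ((hθ'.fun_pow 2).const_mul _)).add (hDz'.const_mul _)
  have hzero : HasDerivAt (fun r => 2 * (1 - c₀) * Rf (L r) - 2 * c₁ * θ (L r) - c₂ * θ (L r) ^ 2 + 4 * c₂ * Dz (L r)) 0 0 := by
    have hev : (fun r => 2 * (1 - c₀) * Rf (L r) - 2 * c₁ * θ (L r) - c₂ * θ (L r) ^ 2 + 4 * c₂ * Dz (L r)) = fun _ => S W := by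
      funext r; rw [← hφ r, hSconst r]
    rw [hev]; exact hasDerivAt_const 0 _
  have hkey := hcomb.unique hzero
  norm_num at hkey
  have hρ : (1 - c₀) ≠ 0 := sub_ne_zero.2 (Ne.symm hμ1)
  field_simp
  linear_combination (1 / 2 : ℝ) * hkey

/-- ★★ **THE SAME AT A GENERAL TIME AND A HORIZONTALLY CRITICAL POINT** (LEAD g17's B-SPEED(τ) request, T2B-g17 v2 §5(5c): a NON-hot sonic sheet of
`e`-parallel lines at time `t = −1+τ`, `∂_zU₂ ≠ 0` allowed).  Class profile, (TH) slab law with a `C³` slope near the plane `{y₂ = W₂}` at a time `t < 0`,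
`μ(t,W₂) ≠ 1`, and only HORIZONTAL criticality `∇ₕU₂(t,·)(W) = 0`.  Then for every `e` (`Je` is horizontal):
`D(∂ₜU₂(t,·))(W)[Je] = D(ΔU₂(t,·))(W)[Je] − D²U₂(t,·)(W)[Je][U(t,W)] − 2∂_zμ(t,W₂)·D²U₂(t,·)(W)[Je][e₂]/(1 − μ(t,W₂))`
(the extra convective term `DU₂(W)[DU(W)Je]` vanishes because `(DU(W)Je)₂ = ∂_{Je}U₂(W) = 0`). -/
theorem normalDeriv_timeDeriv_of_horizCritical (hrate : HasTypeITimeDecay C v) (hcont : ContinuousOn (uncurry v) (Iio (0 : ℝ) ×ˢ univ))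
    (hmild : ∀ s t : ℝ, s < t → t < 0 → ∀ x, v t x = heatExtension (v s) (t - s) x - oseenDuhamel 1 s v v t x)
    (hdiv : ∀ t < 0, VectorCalculus.IsDivFree (v t))
    (hpol : ∀ s < 0, ∀ y, ⟪curl (v s) y, EuclideanSpace.single 2 1⟫_ℝ = 0)
    {μ : ℝ → ℝ → ℝ} (hμ : ContDiff ℝ 3 (uncurry μ)) {t : ℝ} (ht : t < 0) {W : EuclideanSpace ℝ (Fin 3)}
    (hslope : ∀ y : EuclideanSpace ℝ (Fin 3), y 2 = W 2 →
      ∀ᶠ z in 𝓝 ((t, y) : ℝ × EuclideanSpace ℝ (Fin 3)), ∀ b : Fin 3, b ≠ 2 →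
        fderiv ℝ (v z.1) z.2 (EuclideanSpace.single 2 1) b = μ z.1 (z.2 2) * fderiv ℝ (v z.1) z.2 (EuclideanSpace.single b 1) 2)
    (hμ1 : μ t (W 2) ≠ 1) (hgradh : ∀ w : EuclideanSpace ℝ (Fin 3), w 2 = 0 → fderiv ℝ (fun x => v t x 2) W w = 0) (e : EuclideanSpace ℝ (Fin 3)) :
    fderiv ℝ (fun x => deriv (fun s => v s x 2) t) W (Jvec e) =
      fderiv ℝ (Δ (fun x => v t x 2)) W (Jvec e) - fderiv ℝ (fderiv ℝ (fun x => v t x 2)) W (Jvec e) (v t W)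
        - 2 * deriv (μ t) (W 2) * fderiv ℝ (fderiv ℝ (fun x => v t x 2)) W (Jvec e) (EuclideanSpace.single 2 1) / (1 - μ t (W 2)) := by
  have h1 : t ∈ Iio (0 : ℝ) := ht
  set θ : EuclideanSpace ℝ (Fin 3) → ℝ := fun x => v t x 2 with hθdef
  set ν : EuclideanSpace ℝ (Fin 3) := Jvec e with hν
  have hν2 : ν 2 = 0 := by simp [hν, Jvec]
  -- regularity
  have hA : IsTypeIAncientMild C v := isTypeIAncientMild_of_class hrate hcont hmild hdiv
  have hsm : IsSmoothSpaceTimeOn (Iio 0) v := hA.contDiffOn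
  have hslice : ContDiff ℝ ∞ (v t) := hsm.contDiff_slice h1
  have hvd : Differentiable ℝ (v t) := hslice.differentiable (by simp)
  have hθ3 : ContDiff ℝ 3 θ := PoloidalWindowDoorPoloidalWindowRigidityConstantShearMeans.contDiff_coord (hslice.of_le (by norm_cast)) 2
  have hθ2 : ContDiff ℝ 2 θ := hθ3.of_le (by norm_num)
  have hθd : Differentiable ℝ θ := hθ3.differentiable (by norm_num)
  have hDθd : Differentiable ℝ (fderiv ℝ θ) := (hθ3.fderiv_right (m := 2) (by norm_num)).differentiable (by norm_num)
  have hθt := (isSmoothSpaceTimeOn_two hrate hcont hmild).isSmoothSpaceTimeOn_deriv isOpen_Iio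
  have hθtd : DifferentiableAt ℝ (fun x => deriv (fun s => v s x 2) t) W := ((hθt.contDiff_slice h1).differentiable (by simp)) W
  have hΔd : DifferentiableAt ℝ (Δ θ) W := differentiableAt_laplacian_of_contDiffAt hθ3.contDiffAt
  -- horizontal criticality: `Dθ(W)[ν] = 0` and `Dθ(W)[DU(W)ν] = 0`
  have hθν : fderiv ℝ θ W ν = 0 := hgradh ν hν2
  have hconvν : fderiv ℝ θ W (fderiv ℝ (v t) W ν) = 0 := by
    refine hgradh _ ?_
    rw [← fderiv_apply_coord (v t) (hvd W) ν 2]; exact hθν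
  -- the residual `f₂(y) = ∂ₜv₂ + Dv₂[v] − Δv₂` as a function of `y`
  have hres : ∀ y : EuclideanSpace ℝ (Fin 3), (timeDerivWithin (Iio 0) v t y + convect (v t) (v t) y - Δ (v t) y) 2 =
      deriv (fun s => v s y 2) t + fderiv ℝ θ y (v t y) - (Δ θ) y := by
    intro y
    simp only [PiLp.add_apply, PiLp.sub_apply]
    rw [timeDerivWithin_eq_deriv isOpen_Iio h1 v y, deriv_apply_coord (hsm.hasDerivAt_timeLine isOpen_Iio h1 y).differentiableAt 2,
      convect_apply, ← fderiv_apply_coord (v t) (hvd y) (v t y) 2,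
      laplacian_apply_coord ((hslice.of_le (by norm_cast)).contDiffAt) 2]
  -- the source along the horizontal line `r ↦ W + r·ν` is constant
  set L : ℝ → EuclideanSpace ℝ (Fin 3) := fun r => W + r • ν with hL
  have hL2 : ∀ r, (L r) 2 = W 2 := fun r => by simp [hL, hν2]
  have hLd : ∀ r, HasDerivAt L ν r := fun r => by
    have h := ((hasDerivAt_id r).smul_const ν).const_add W
    simpa [hL] using h
  set S : EuclideanSpace ℝ (Fin 3) → ℝ := fun y =>
    2 * (1 - μ t (y 2)) * (timeDerivWithin (Iio 0) v t y + convect (v t) (v t) y - Δ (v t) y) 2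
      - 2 * (deriv (fun s => μ s (y 2)) t - deriv (deriv (μ t)) (y 2)) * v t y 2
      - deriv (μ t) (y 2) * v t y 2 ^ 2
      + 4 * deriv (μ t) (y 2) * fderiv ℝ (v t) y (EuclideanSpace.single 2 1) 2 with hS
  have hSconst : ∀ r, S (L r) = S W := fun r =>
    weightSource_eq_of_height_eq hrate hcont hmild hdiv hpol hμ ht (hL2 r) (fun y hy => hslope y (by rw [hy, hL2]))
  set c₀ : ℝ := μ t (W 2) with hc₀
  set c₁ : ℝ := deriv (fun s => μ s (W 2)) t - deriv (deriv (μ t)) (W 2) with hc₁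
  set c₂ : ℝ := deriv (μ t) (W 2) with hc₂
  set Rf : EuclideanSpace ℝ (Fin 3) → ℝ := fun y => deriv (fun s => v s y 2) t + fderiv ℝ θ y (v t y) - (Δ θ) y with hRf
  set Dz : EuclideanSpace ℝ (Fin 3) → ℝ := fun y => fderiv ℝ θ y (EuclideanSpace.single 2 1) with hDz
  have hφ : ∀ r, S (L r) = 2 * (1 - c₀) * Rf (L r) - 2 * c₁ * θ (L r) - c₂ * θ (L r) ^ 2 + 4 * c₂ * Dz (L r) := by
    intro r
    simp only [hS, hRf, hDz, hθdef, hL2 r, hres, hc₀, hc₁, hc₂, ← fderiv_apply_coord (v t) (hvd (L r))]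
  have hL0 : L 0 = W := by simp [hL]
  have hRfd : HasFDerivAt Rf (fderiv ℝ (fun x => deriv (fun s => v s x 2) t) W +
      ((fderiv ℝ θ W).comp (fderiv ℝ (v t) W) + (fderiv ℝ (fderiv ℝ θ) W).flip (v t W)) - fderiv ℝ (Δ θ) W) W := by
    have hC : HasFDerivAt (fun y => fderiv ℝ θ y (v t y)) ((fderiv ℝ θ W).comp (fderiv ℝ (v t) W) + (fderiv ℝ (fderiv ℝ θ) W).flip (v t W)) W :=
      ((hDθd W).hasFDerivAt).clm_apply ((hvd W).hasFDerivAt)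
    exact (hθtd.hasFDerivAt.add hC).sub hΔd.hasFDerivAt
  have hRf' : HasDerivAt (fun r => Rf (L r)) (fderiv ℝ (fun x => deriv (fun s => v s x 2) t) W ν +
      fderiv ℝ (fderiv ℝ θ) W ν (v t W) - fderiv ℝ (Δ θ) W ν) 0 := by
    have h := hRfd.comp_hasDerivAt_of_eq (0 : ℝ) (hLd 0) hL0.symm
    refine h.congr_deriv ?_
    simp only [sub_apply, add_apply, ContinuousLinearMap.comp_apply, ContinuousLinearMap.flip_apply, hconvν, zero_add]
  have hθ' : HasDerivAt (fun r => θ (L r)) 0 0 := by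
    have h := ((hθd W).hasFDerivAt).comp_hasDerivAt_of_eq (0 : ℝ) (hLd 0) hL0.symm
    exact h.congr_deriv (by simp [hθν])
  have hDz' : HasDerivAt (fun r => Dz (L r)) (fderiv ℝ (fderiv ℝ θ) W ν (EuclideanSpace.single 2 1)) 0 := by
    have hd : DifferentiableAt ℝ Dz W := (hDθd W).clm_apply (differentiableAt_const _)
    have h := hd.hasFDerivAt.comp_hasDerivAt_of_eq (0 : ℝ) (hLd 0) hL0.symm
    refine h.congr_deriv ?_
    rw [hDz, nested_eq_fderiv_fderiv hθ2]
  have hcomb : HasDerivAt (fun r => 2 * (1 - c₀) * Rf (L r) - 2 * c₁ * θ (L r) - c₂ * θ (L r) ^ 2 + 4 * c₂ * Dz (L r))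
      (2 * (1 - c₀) * (fderiv ℝ (fun x => deriv (fun s => v s x 2) t) W ν + fderiv ℝ (fderiv ℝ θ) W ν (v t W) - fderiv ℝ (Δ θ) W ν)
        - 2 * c₁ * 0 - c₂ * (↑2 * θ (L 0) ^ (2 - 1) * 0) + 4 * c₂ * fderiv ℝ (fderiv ℝ θ) W ν (EuclideanSpace.single 2 1)) 0 :=
    (((hRf'.const_mul _).sub (hθ'.const_mul _)).sub ((hθ'.fun_pow 2).const_mul _)).add (hDz'.const_mul _)
  have hzero : HasDerivAt (fun r => 2 * (1 - c₀) * Rf (L r) - 2 * c₁ * θ (L r) - c₂ * θ (L r) ^ 2 + 4 * c₂ * Dz (L r)) 0 0 := by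
    have hev : (fun r => 2 * (1 - c₀) * Rf (L r) - 2 * c₁ * θ (L r) - c₂ * θ (L r) ^ 2 + 4 * c₂ * Dz (L r)) = fun _ => S W := by
      funext r; rw [← hφ r, hSconst r]
    rw [hev]; exact hasDerivAt_const 0 _
  have hkey := hcomb.unique hzero
  norm_num at hkey
  have hρ : (1 - c₀) ≠ 0 := sub_ne_zero.2 (Ne.symm hμ1)
  field_simp
  linear_combination (1 / 2 : ℝ) * hkey

end Summit.NavierStokesRegularity.NavierStokesRegularity.Theorems.PoloidalWindowDoorLrcModEntireQ4SonicSheetSpeedClass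

end
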